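import Mathlib
import Summits.Ventures.HodgeRepro.Tier4.Target
import Summits.Ventures.HodgeRepro.Tier4.Common.TargetData
import Summits.Ventures.HodgeRepro.Tier4.Common.TargetBall
import Summits.Ventures.HodgeRepro.Tier4.Common.AutForms
import Summits.Ventures.HodgeRepro.Tier4.Common.BallBounds
import Summits.Ventures.HodgeRepro.Tier4.Common.FundamentalDomain
import Summits.Ventures.HodgeRepro.Tier4.Common.ProperDiscontinuity
import Summits.Ventures.HodgeRepro.Tier4.LitCompactness

/-!
# Tier4/Common/ProperlyDiscontinuous — the displayed input «(P) proper discontinuity» is a THEOREM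

Blind re-derivation cell `pub-hodge-repro`, Tier 4 «prove the step» (README §9–§10), seat t4-L4-p1 (prover, LINE L4,
gen 0).  Tree path `lean/Summits/Ventures/HodgeRepro/Tier4/Common/ProperlyDiscontinuous.lean`.

WHAT IS PROVED.  `properlyDiscontinuous_hdef_holds E H τ₀ C : Lit.BorelHarishChandra1962_properlyDiscontinuous_hdef E H τ₀ C`
— the Prop of `Tier4/LitCompactness.lean` (t4-lit-3) that L4.0′ `pair11_descends` (L4 v0.7 L221) and the partition
function of `Tier4/Line4/Partition.lean` DISPLAY as a printed input: for ANY CM number field `E`, `c`-hermitian `H` with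
Sylvester matrix `C` at `τ₀` and DEFINITE at every other embedding, every congruence subgroup `Γ′` of `U(H)` and every
compact `K ⊆ 𝔹²`, finitely many `γ ∈ Γ′` satisfy `γ K ∩ K ≠ ∅`.  The proof is that of `Tier4/Common/FundamentalDomain.lean`
(`finite_bounded_part`) and `Tier4/Common/ProperDiscontinuity.lean` (`finite_meets_compact`) with the datum's fields
replaced by the Prop's own premises — it uses only: integral entries and `H`-unitarity of `Γ′` (`principalCongruence`),
definiteness of `τ(H)` at `τ ≠ τ₀, τ̄₀` (`exists_bound_of_isDefinite`), the transfer `τ₀(γ) = C · M(γ) · C⁻¹`, Mathlib's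
`NumberField.Embeddings.finite_of_norm_le`, and the `U(2,1)` bound `norm_entry_le_of_mem_ball`.  No anisotropy, no
Galois hypothesis, no literature.

HC_CM is NOT proved by anyone in this repository.
-/

set_option autoImplicit false

noncomputable section

open Matrix Metric NumberField MeasureTheory
open scoped ComplexConjugate ComplexOrder

namespace Summit.Ventures.HodgeRepro.Tier4

section General

variable {E : Type} [Field E] [NumberField E] [IsCMField E]
  {H : Matrix (Fin 3) (Fin 3) E} {τ₀ : E →+* ℂ} {C : Matrix (Fin 3) (Fin 3) ℂ}

/-- At every embedding `τ`, `τ(γ)` preserves `τ(H)` for `γ ∈ U(H)` (datum-free). -/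
theorem map_conjTranspose_mul_map' (τ : E →+* ℂ) {γ : Matrix (Fin 3) (Fin 3) E}
    (hγ : IsUnitaryOf (conjE E) H γ) : (γ.map τ)ᴴ * H.map τ * γ.map τ = H.map τ := by
  rw [conjTranspose_map τ (conjE E) (complexConj_intertwines E τ), ← Matrix.map_mul, ← Matrix.map_mul]
  unfold IsUnitaryOf at hγ
  rw [hγ]

omit [NumberField E] [IsCMField E] in
/-- `τ₀(γ) = C · M(γ) · C⁻¹` (datum-free). -/
theorem map_τ₀_eq' (hC : IsUnit C) (γ : Matrix (Fin 3) (Fin 3) E) :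
    γ.map τ₀ = C * toBallMat τ₀ C γ * C⁻¹ := by
  have hdet : IsUnit C.det := (Matrix.isUnit_iff_isUnit_det C).mp hC
  have hCC : C * C⁻¹ = 1 := Matrix.mul_nonsing_inv C hdet
  unfold toBallMat
  calc γ.map τ₀ = (C * C⁻¹) * γ.map τ₀ * (C * C⁻¹) := by rw [hCC, Matrix.one_mul, Matrix.mul_one]
    _ = C * (C⁻¹ * γ.map τ₀ * C) * C⁻¹ := by simp only [Matrix.mul_assoc]

omit [NumberField E] [IsCMField E] in
/-- At `τ₀`, a bound on the ball matrix bounds `τ₀(γ)` (datum-free). -/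
theorem norm_τ₀_le' (hC : IsUnit C) {γ : Matrix (Fin 3) (Fin 3) E} {K : ℝ}
    (hK : ∀ i j, ‖toBallMat τ₀ C γ i j‖ ≤ K) (i j : Fin 3) :
    ‖τ₀ (γ i j)‖ ≤ 3 * (9 * (3 * (cnorm C * (9 * K))) * cnorm C⁻¹) := by
  have h1 : ‖τ₀ (γ i j)‖ = ‖(C * toBallMat τ₀ C γ * C⁻¹) i j‖ := by
    rw [← map_τ₀_eq' hC, Matrix.map_apply]
  rw [h1]
  refine (norm_mul_apply_le _ _ i j).trans ?_
  have h2 : cnorm (C * toBallMat τ₀ C γ) ≤ 9 * (3 * (cnorm C * (9 * K))) := by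
    refine cnorm_le_of_forall fun a b => (norm_mul_apply_le _ _ a b).trans ?_
    have h3 : cnorm (toBallMat τ₀ C γ) ≤ 9 * K := cnorm_le_of_forall hK
    have h4 : 0 ≤ cnorm C := cnorm_nonneg _
    gcongr
  have h5 : 0 ≤ cnorm C⁻¹ := cnorm_nonneg _
  gcongr

/-- **Discreteness, datum-free**: for a congruence subgroup `Γ′` of `U(H)`, with `H` definite at every embedding other
than `τ₀, τ̄₀` and `C` invertible, only finitely many `γ ∈ Γ′` have a ball matrix with entries `≤ K`. -/
theorem finite_bounded_part' (hC : IsUnit C) (hdef : ∀ τ : E →+* ℂ, τ ≠ τ₀ → τ ≠ conjEmb τ₀ → IsDefinite (H.map τ))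
    {Γ' : Set (Matrix (Fin 3) (Fin 3) E)} (hΓ' : IsCongruenceSubgroup (conjE E) H Γ') (K : ℝ) :
    {γ : Matrix (Fin 3) (Fin 3) E | γ ∈ Γ' ∧ ∀ i j, ‖toBallMat τ₀ C γ i j‖ ≤ K}.Finite := by
  have hunit : ∀ γ ∈ Γ', IsUnitaryOf (conjE E) H γ := fun γ hγ => (hΓ'.2.2.2.1 hγ).1
  have hint : ∀ γ ∈ Γ', ∀ i j, IsIntegral ℤ (γ i j) := fun γ hγ => (hΓ'.2.2.2.1 hγ).2.1
  -- a bound at every embedding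
  have hτ : ∀ φ : E →+* ℂ, ∃ B : ℝ, ∀ γ ∈ Γ', (∀ i j, ‖toBallMat τ₀ C γ i j‖ ≤ K) →
      ∀ i j, ‖φ (γ i j)‖ ≤ B := by
    intro φ
    by_cases h0 : φ = τ₀
    · subst h0
      exact ⟨_, fun γ _ hK i j => norm_τ₀_le' hC hK i j⟩
    by_cases h1 : φ = conjEmb τ₀
    · subst h1
      exact ⟨_, fun γ _ hK i j => by rw [norm_conjEmb_apply]; exact norm_τ₀_le' hC hK i j⟩
    obtain ⟨B, hB⟩ := exists_bound_of_isDefinite (hdef φ h0 h1)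
    refine ⟨B, fun γ hγ _ i j => ?_⟩
    have := hB _ (map_conjTranspose_mul_map' φ (hunit γ hγ)) i j
    simpa [Matrix.map_apply] using this
  choose Bd hBd using hτ
  set B : ℝ := ∑ φ : E →+* ℂ, |Bd φ| with hBdef
  have hB : ∀ γ ∈ Γ', (∀ i j, ‖toBallMat τ₀ C γ i j‖ ≤ K) → ∀ φ : E →+* ℂ, ∀ i j, ‖φ (γ i j)‖ ≤ B := by
    intro γ hγ hK φ i j
    refine (hBd φ γ hγ hK i j).trans ?_
    calc Bd φ ≤ |Bd φ| := le_abs_self _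
      _ ≤ ∑ ψ : E →+* ℂ, |Bd ψ| :=
          Finset.single_le_sum (f := fun ψ => |Bd ψ|) (fun ψ _ => abs_nonneg _) (Finset.mem_univ φ)
  set S : Set E := {x : E | IsIntegral ℤ x ∧ ∀ φ : E →+* ℂ, ‖φ x‖ ≤ B} with hS
  have hSfin : S.Finite := NumberField.Embeddings.finite_of_norm_le E ℂ B
  have hpi : (Set.univ.pi fun _ : Fin 3 => Set.univ.pi fun _ : Fin 3 => S).Finite :=
    Set.Finite.pi fun _ => Set.Finite.pi fun _ => hSfin
  refine hpi.subset fun γ ⟨hγ, hK⟩ => ?_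
  rw [Set.mem_univ_pi]
  intro i
  rw [Set.mem_univ_pi]
  intro j
  exact ⟨hint γ hγ i j, fun φ => hB γ hγ hK φ i j⟩

/-- **Proper discontinuity on `{nsq ≤ t²}`, datum-free.** -/
theorem finite_meets_nsqBall' (hC : IsSylvester (H.map τ₀) C)
    (hdef : ∀ τ : E →+* ℂ, τ ≠ τ₀ → τ ≠ conjEmb τ₀ → IsDefinite (H.map τ))
    {Γ' : Set (Matrix (Fin 3) (Fin 3) E)} (hΓ' : IsCongruenceSubgroup (conjE E) H Γ') {t : ℝ} (ht0 : 0 ≤ t)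
    (ht1 : t < 1) :
    {γ | γ ∈ Γ' ∧ ∃ z, nsq z ≤ t ^ 2 ∧ nsq (actM (toBallMat τ₀ C γ) z) ≤ t ^ 2}.Finite := by
  refine (finite_bounded_part' hC.1 hdef hΓ' (1 / ((1 - t) * Real.sqrt (1 - t ^ 2)))).subset ?_
  rintro γ ⟨hγ, z, hz, hw⟩
  have hzb : z ∈ ball := by
    show nsq z < 1
    nlinarith
  have hM : (toBallMat τ₀ C γ)ᴴ * J * toBallMat τ₀ C γ = J :=
    toBallMat_J τ₀ (conjE E) (complexConj_intertwines E τ₀) hC (hΓ'.2.2.2.1 hγ).1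
  exact ⟨hγ, fun i j => norm_entry_le_of_mem_ball hM hzb ht0 ht1 hz hw i j⟩

/-- **(P) IS A THEOREM**: the displayed proper-discontinuity input of `Tier4/LitCompactness.lean` holds for every
`(E, H, τ₀, C)` satisfying its premises. -/
theorem properlyDiscontinuous_hdef_holds (E : Type) [Field E] [NumberField E] [IsCMField E]
    (H : Matrix (Fin 3) (Fin 3) E) (τ₀ : E →+* ℂ) (C : Matrix (Fin 3) (Fin 3) ℂ) :
    Lit.BorelHarishChandra1962_properlyDiscontinuous_hdef E H τ₀ C := by
  intro _ _ hC hdef Γ' hΓ' K hK hKb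
  obtain ⟨t, ht0, ht1, hKt⟩ := exists_nsq_le_of_isCompact hK hKb
  refine (finite_meets_nsqBall' hC hdef hΓ' ht0 ht1).subset ?_
  rintro γ ⟨hγ, z, hz, hw⟩
  exact ⟨hγ, z, hKt z hz, hKt _ hw⟩

end General

end Summit.Ventures.HodgeRepro.Tier4

end

#print axioms Summit.Ventures.HodgeRepro.Tier4.properlyDiscontinuous_hdef_holds
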